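import Summits.BirchSwinnertonDyer.BirchSwinnertonDyer.Theorems.PrintCFramBottomClassIndexLawFiveLeSelmerCountCoalignedOfLocal
import Summits.BirchSwinnertonDyer.BirchSwinnertonDyer.Theorems.PrintCFramBottomClassIndexLawFiveLeSelmerCountReverseBridge
import HarnessLib

/-!
# Route `PrintCFram`, crux C2 `BottomClassIndexLawFiveLe` (stmt-BirchSwinnertonDyer-20372), line
# `eisenstein-resource-bdp-line` (registry v21, stubs B1-level `stub_bsdp_of_level` / B1-sha `stub_bsdp_of_sha`):
# **THE CHARACTER SUPPLY COUNT** — two INDEPENDENT admissible `θ`-isotypic characters of `Γ_L` give `#H¹(Γ_ℚ, A; S) ≥ p²`,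
# hence, on the CM-ramified class, (LA) ∧ two such characters ⟹ `Ш(W/ℚ)[p] ≠ 0`
# (cell `bsd-print-cfram`, width seat `bsd-line-cfram-p1-w2` g11; helper `--supports` 20372; 0 defs, 0 facts, 0 sorry;
# CONDITIONAL on the tree's named fact `localEulerPoincareCharacteristic ℚ_v` exactly as `…SelmerCountCoalignedOfLocal`)

HONEST FRAMING. Nothing about BSD is proved here and no stub is closed. This is the COUNTING step «L4» of the B1-sha
branch of the first-order Selmer census (seat notes w2g10 §5(1)/§7, HOME/STATUS 2026-08-29T00:43:53Z w7 g4): the reverse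
bridge `SelmerCount.natCard_characters_le_natCard_h1Unramified` (w2 g10, p682362) injects any finite group `V` of admissible
characters `κ : Γ_L →* 𝔽_p` (open kernel, killing the inertia groups above the places outside `S`, `θ`-isotypic under the
outer action `absGaloisOuterConj ℚ L`) into `H¹(Γ_ℚ, A; S) = h1Unramified A S`; the Kummer lane (w7 g4:
`KummerRadical.exists_kummer_character`, `…_eq_one_of_mem_inertia`, `…_absGaloisOuterConj`, `UnitGalois.exists_even_eigenunit`,
and the class radical) produces such characters ONE AT A TIME. This file turns «two independent admissible characters» into
«`p² ≤ #h1Unramified A S`» (pure group bookkeeping: the subgroup generated by two commuting elements of exponent `p` with no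
relation has `p²` elements, and admissibility is closed under products) and composes with w2 g10's
`exists_sha_ne_zero_of_forall_exists_adaptedRoot_of_sq_le_of_cmRamified` (p681509).

* §1 `character_pow_prime` (`κ^p = 1`), `exists_eq_pow_mul_pow_of_mem_closure_pair` (every element of `closure {κ₁, κ₂}` is
  `κ₁^a κ₂^b`, `a, b < p`), `finite_closure_pair`, **`sq_le_natCard_closure_pair`** (INDEPENDENT — `κ₁^a κ₂^b = 1 → p ∣ a ∧ p ∣ b`
  — ⟹ `p² ≤ #closure {κ₁, κ₂}`).
* §2 admissibility is closed under `κ₁^a κ₂^b`: `isOpen_ker_pow_mul_pow`, `pow_mul_pow_apply_eq_one`, `pow_mul_pow_apply_eq_pow`.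
* §3 **`sq_le_natCard_h1Unramified_of_two_characters`** — the bridge's data (`#A = p`, character `θ`, `L/ℚ` Galois, `p ∤ [L:ℚ]`,
  `θ(res Γ_L) = 1`, `S` finite) and two admissible independent characters ⊢ `p² ≤ #h1Unramified A S`.
* §4 **`exists_sha_ne_zero_of_forall_exists_adaptedRoot_of_two_characters_of_cmRamified`** — class member (`W/ℚ` minimal with CM,
  `CMRamified W p`, `p ≥ 5`), `rank W(ℚ) = 1`, `v ∋ p`, a stable line `Φ` of order `p` with character `θ` satisfying w6 g4's (LA) at `v`,
  `L/ℚ` Galois with `p ∤ [L:ℚ]` and `θ(res Γ_L) = 1`, two admissible (unramified above `u ∤ p`) independent `θ`-isotypic characters of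
  `Γ_L`, and `localEulerPoincareCharacteristic ℚ_v` ⊢ **`∃ c ∈ Ш(W/ℚ), c ≠ 0 ∧ p • c = 0`**.

USE (B1-sha, CASE R ∧ EVEN-IRREGULAR): `A = Φ.Sub = 𝔽_p(ψ)` the odd line, `L = K'` the CM field of w6 g3's
`LevelDictionaryAlpha.exists_cmField_of_character`, `κ₁` = the Kummer character of Herbrand's `θ_e`-unit (w7 g4 L1+K1+K2), `κ₂` = the
Kummer character of a `θ_e`-class radical (w7 g4 L3); their independence is Kummer theory on the radicands (sequel file
`…SelmerCountKummerSupply`). THEOREMS ONLY; no definition, no named fact, no `sorry`. BSD is not proved by any of this; no summit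
statement is proved by this seat. References: [Washington1997] §10.2 (reflection); [SerreGaloisCohomology1997] I.§2.6 (b);
[MilneADT2006] I Thm. 2.8; seat notes w2g9, w2g10 §5, w7g4.
-/

set_option autoImplicit false
-- `…BirchSwinnertonDyer.BirchSwinnertonDyer.Theorems…` is the problem's mandated namespace (D-0017).
set_option linter.dupNamespace false

noncomputable section

open scoped Classical

namespace Summit.BirchSwinnertonDyer.BirchSwinnertonDyer.Theorems.PrintCFram.SelmerCount

open NumberField IsDedekindDomain Field WeierstrassCurve
open Literature.NumberTheory.EllipticCurves Literature.NumberTheory.GaloisRepresentations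
  Literature.NumberTheory.EllipticCurves.GreenbergSelmer Literature.NumberTheory.EllipticCurves.Rank1Residual
open Summit.BirchSwinnertonDyer.Rank1Residual.X2.ResidualDevissageModules

/-! ## §1 Two independent characters of exponent `p` generate `p²` characters -/

section Count

variable {Γ : Type} [Group Γ] {p : ℕ} [hp : Fact p.Prime]

/-- `κ^p = 1` for a character `κ : Γ →* ℤ/p` (multiplicative notation). [folklore] -/
theorem character_pow_prime (κ : Γ →* Multiplicative (ZMod p)) : κ ^ p = 1 := by
  ext σ
  rw [MonoidHom.pow_apply, MonoidHom.one_apply, ← ofAdd_toAdd (κ σ), ← ofAdd_nsmul, nsmul_eq_mul,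
    ZMod.natCast_self, zero_mul, ofAdd_zero]

/-- Every element of the subgroup generated by two characters `κ₁, κ₂ : Γ →* ℤ/p` is `κ₁^a κ₂^b` with `a, b < p`
(the characters commute and have exponent `p`). [folklore] -/
theorem exists_eq_pow_mul_pow_of_mem_closure_pair {κ₁ κ₂ κ : Γ →* Multiplicative (ZMod p)}
    (h : κ ∈ Subgroup.closure ({κ₁, κ₂} : Set (Γ →* Multiplicative (ZMod p)))) :
    ∃ a b : ℕ, a < p ∧ b < p ∧ κ = κ₁ ^ a * κ₂ ^ b := by
  obtain ⟨m, n, hmn⟩ := Subgroup.mem_closure_pair.1 h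
  have hp0 : ((p : ℕ) : ℤ) ≠ 0 := by exact_mod_cast hp.out.ne_zero
  have hred : ∀ (x : Γ →* Multiplicative (ZMod p)) (m : ℤ), ∃ a : ℕ, a < p ∧ x ^ m = x ^ a := by
    intro x m
    refine ⟨(m % (p : ℕ)).natAbs, ?_, ?_⟩
    · have h2 : (((m % (p : ℕ) : ℤ)).natAbs : ℤ) < p := by
        rw [Int.natAbs_of_nonneg (Int.emod_nonneg _ hp0)]
        exact Int.emod_lt_of_pos _ (by exact_mod_cast hp.out.pos)
      exact_mod_cast h2
    · rw [zpow_eq_zpow_emod' m (character_pow_prime x), ← zpow_natCast,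
        Int.natAbs_of_nonneg (Int.emod_nonneg _ hp0)]
  obtain ⟨a, ha, hma⟩ := hred κ₁ m
  obtain ⟨b, hb, hnb⟩ := hred κ₂ n
  exact ⟨a, b, ha, hb, by rw [← hmn, hma, hnb]⟩

/-- The subgroup generated by two characters `Γ →* ℤ/p` is finite (at most `p²` elements). [folklore] -/
theorem finite_closure_pair (κ₁ κ₂ : Γ →* Multiplicative (ZMod p)) :
    Finite (Subgroup.closure ({κ₁, κ₂} : Set (Γ →* Multiplicative (ZMod p)))) := by
  let f : Fin p × Fin p → (Γ →* Multiplicative (ZMod p)) := fun ab => κ₁ ^ (ab.1 : ℕ) * κ₂ ^ (ab.2 : ℕ)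
  have hsub : ((Subgroup.closure ({κ₁, κ₂} : Set (Γ →* Multiplicative (ZMod p))) : Subgroup _) :
      Set (Γ →* Multiplicative (ZMod p))) ⊆ Set.range f := by
    intro κ hκ
    obtain ⟨a, b, ha, hb, rfl⟩ := exists_eq_pow_mul_pow_of_mem_closure_pair hκ
    exact ⟨(⟨a, ha⟩, ⟨b, hb⟩), rfl⟩
  exact ((Set.finite_range f).subset hsub).to_subtype

/-- **Two INDEPENDENT characters generate at least `p²` characters.** If `κ₁^a κ₂^b = 1` forces `p ∣ a` and `p ∣ b`, then
`(a, b) ↦ κ₁^a κ₂^b`, `(ℤ/p)² → closure {κ₁, κ₂}`, is injective, so `p² ≤ #closure {κ₁, κ₂}` (in fact `=`). [folklore] -/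
theorem sq_le_natCard_closure_pair {κ₁ κ₂ : Γ →* Multiplicative (ZMod p)}
    (hind : ∀ a b : ℕ, κ₁ ^ a * κ₂ ^ b = 1 → p ∣ a ∧ p ∣ b) :
    p ^ 2 ≤ Nat.card (Subgroup.closure ({κ₁, κ₂} : Set (Γ →* Multiplicative (ZMod p)))) := by
  haveI : NeZero p := ⟨hp.out.ne_zero⟩
  haveI := finite_closure_pair κ₁ κ₂
  set V := Subgroup.closure ({κ₁, κ₂} : Set (Γ →* Multiplicative (ZMod p))) with hV
  have h1 : κ₁ ∈ V := Subgroup.subset_closure (by simp)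
  have h2 : κ₂ ∈ V := Subgroup.subset_closure (by simp)
  let f : ZMod p × ZMod p → V := fun ab =>
    ⟨κ₁ ^ ab.1.val * κ₂ ^ ab.2.val, V.mul_mem (V.pow_mem h1 _) (V.pow_mem h2 _)⟩
  -- `p ∣ x.val + (p − x'.val)` forces `x = x'`
  have hmod : ∀ {x x' : ZMod p}, p ∣ x.val + (p - x'.val) → x = x' := by
    intro x x' hdvd
    have hx' : x'.val ≤ p := (ZMod.val_lt x').le
    have h0 : ((x.val + (p - x'.val) : ℕ) : ZMod p) = 0 := (ZMod.natCast_eq_zero_iff _ _).2 hdvd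
    rw [Nat.cast_add, Nat.cast_sub hx', ZMod.natCast_zmod_val, ZMod.natCast_self, ZMod.natCast_zmod_val, zero_sub,
      ← sub_eq_add_neg, sub_eq_zero] at h0
    exact h0
  have hf : Function.Injective f := by
    rintro ⟨a, b⟩ ⟨a', b'⟩ h
    have h' : κ₁ ^ a.val * κ₂ ^ b.val = κ₁ ^ a'.val * κ₂ ^ b'.val := by
      simpa only [f, Subtype.mk.injEq] using h
    have ha' : a'.val ≤ p := (ZMod.val_lt a').le
    have hb' : b'.val ≤ p := (ZMod.val_lt b').le
    have key : κ₁ ^ (a.val + (p - a'.val)) * κ₂ ^ (b.val + (p - b'.val)) = 1 := by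
      calc κ₁ ^ (a.val + (p - a'.val)) * κ₂ ^ (b.val + (p - b'.val))
          = (κ₁ ^ a.val * κ₂ ^ b.val) * (κ₁ ^ (p - a'.val) * κ₂ ^ (p - b'.val)) := by
            rw [pow_add, pow_add, mul_mul_mul_comm]
        _ = (κ₁ ^ a'.val * κ₂ ^ b'.val) * (κ₁ ^ (p - a'.val) * κ₂ ^ (p - b'.val)) := by rw [h']
        _ = κ₁ ^ (a'.val + (p - a'.val)) * κ₂ ^ (b'.val + (p - b'.val)) := by
            rw [pow_add, pow_add, mul_mul_mul_comm]
        _ = 1 := by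
            rw [Nat.add_sub_cancel' ha', Nat.add_sub_cancel' hb', character_pow_prime, character_pow_prime, mul_one]
    obtain ⟨hpa, hpb⟩ := hind _ _ key
    rw [hmod hpa, hmod hpb]
  calc p ^ 2 = Nat.card (ZMod p × ZMod p) := by rw [Nat.card_prod, Nat.card_zmod, sq]
    _ ≤ Nat.card V := Nat.card_le_card_of_injective f hf

end Count

/-! ## §2 Admissibility is closed under products -/

section Admissible

variable {Γ : Type} [Group Γ] {p : ℕ}

/-- The kernel of `κ₁^a κ₂^b` contains `ker κ₁ ∩ ker κ₂`; so it is open when both kernels are. [folklore] -/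
theorem isOpen_ker_pow_mul_pow [TopologicalSpace Γ] [ContinuousMul Γ] {κ₁ κ₂ : Γ →* Multiplicative (ZMod p)}
    (h₁ : IsOpen (κ₁.ker : Set Γ)) (h₂ : IsOpen (κ₂.ker : Set Γ)) (a b : ℕ) :
    IsOpen ((κ₁ ^ a * κ₂ ^ b).ker : Set Γ) := by
  refine Subgroup.isOpen_mono (H₁ := κ₁.ker ⊓ κ₂.ker) (fun σ hσ => ?_) ?_
  · obtain ⟨hσ₁, hσ₂⟩ := Subgroup.mem_inf.1 hσ
    rw [MonoidHom.mem_ker] at hσ₁ hσ₂ ⊢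
    rw [MonoidHom.mul_apply, MonoidHom.pow_apply, MonoidHom.pow_apply, hσ₁, hσ₂, one_pow, one_pow, mul_one]
  · rw [Subgroup.coe_inf]
    exact h₁.inter h₂

/-- If `κ₁` and `κ₂` kill `g` then so does `κ₁^a κ₂^b` (used for the inertia groups above the places outside `S`). [folklore] -/
theorem pow_mul_pow_apply_eq_one {κ₁ κ₂ : Γ →* Multiplicative (ZMod p)} {g : Γ} (h₁ : κ₁ g = 1) (h₂ : κ₂ g = 1)
    (a b : ℕ) : (κ₁ ^ a * κ₂ ^ b) g = 1 := by
  rw [MonoidHom.mul_apply, MonoidHom.pow_apply, MonoidHom.pow_apply, h₁, h₂, one_pow, one_pow, mul_one]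

/-- If `κ₁` and `κ₂` satisfy the eigen-law `κ g' = (κ g)^n` then so does `κ₁^a κ₂^b` (used with `g' = θ_γ g`, `n = θ(γ)`:
`θ`-isotypy under the outer action of `Γ_ℚ` is closed under products). [folklore] -/
theorem pow_mul_pow_apply_eq_pow {κ₁ κ₂ : Γ →* Multiplicative (ZMod p)} {g g' : Γ} {n : ℕ}
    (h₁ : κ₁ g' = κ₁ g ^ n) (h₂ : κ₂ g' = κ₂ g ^ n) (a b : ℕ) :
    (κ₁ ^ a * κ₂ ^ b) g' = (κ₁ ^ a * κ₂ ^ b) g ^ n := by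
  rw [MonoidHom.mul_apply, MonoidHom.pow_apply, MonoidHom.pow_apply, h₁, h₂, MonoidHom.mul_apply,
    MonoidHom.pow_apply, MonoidHom.pow_apply, mul_pow, ← pow_mul, ← pow_mul, ← pow_mul, ← pow_mul,
    mul_comm n a, mul_comm n b]

end Admissible

/-! ## §3 Two admissible independent characters ⟹ `p² ≤ #H¹(Γ_ℚ, A; S)` -/

section Supply

variable {p : ℕ} [hp : Fact p.Prime]
variable {A : Type} [AddCommGroup A] [DistribMulAction (absoluteGaloisGroup ℚ) A] [TopologicalSpace A] [DiscreteTopology A]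
variable {L : Type} [Field L] [NumberField L] [IsGalois ℚ L]

/-- **THE CHARACTER SUPPLY COUNT.** `A` a discrete `Γ_ℚ`-module of prime order `p` with continuous orbit maps, acted on through
`θ : Γ_ℚ →* 𝔽_pˣ`; `L/ℚ` finite Galois with `p ∤ [L:ℚ]` and `θ(res Γ_L) = 1`; `S` a finite set of places of `ℚ`; `κ₁, κ₂ : Γ_L →* 𝔽_p`
two characters with open kernels, trivial on the inertia group of every prime of `\bar ℤ_L` above a place `u` with `u ∩ ℚ ∉ S`,
`θ`-isotypic under the outer action of `Γ_ℚ` (`κ(θ_γ σ) = κ(σ)^{θ γ}`), and INDEPENDENT (`κ₁^a κ₂^b = 1 → p ∣ a ∧ p ∣ b`). THEN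
**`p² ≤ #h1Unramified A S`**: the subgroup `V = ⟨κ₁, κ₂⟩` has `≥ p²` elements (§1), all admissible (§2), and injects into
`h1Unramified A S` by the reverse bridge `natCard_characters_le_natCard_h1Unramified`. [cite: SerreGaloisCohomology1997, I.§2.6 (b)]
[cite: Washington1997, §10.2 (reflection: the Kummer characters of the even radicals)] -/
theorem sq_le_natCard_h1Unramified_of_two_characters (hcard : Nat.card A = p)
    (hcont : ∀ a : A, Continuous fun g : absoluteGaloisGroup ℚ ↦ g • a)
    (θ : absoluteGaloisGroup ℚ →* (ZMod p)ˣ)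
    (hθ : ∀ (g : absoluteGaloisGroup ℚ) (a : A), g • a = (((θ g : ZMod p).val : ℕ) : ℤ) • a)
    (hpL : ¬ p ∣ Module.finrank ℚ L) (hrL : ∀ σ : absoluteGaloisGroup L, θ (absGaloisRestrict ℚ L σ) = 1)
    {S : Set (HeightOneSpectrum (𝓞 ℚ))} (hS : S.Finite)
    (κ₁ κ₂ : absoluteGaloisGroup L →* Multiplicative (ZMod p))
    (hopen₁ : IsOpen (κ₁.ker : Set (absoluteGaloisGroup L))) (hopen₂ : IsOpen (κ₂.ker : Set (absoluteGaloisGroup L)))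
    (hunr₁ : ∀ u : HeightOneSpectrum (𝓞 L), u.under (𝓞 ℚ) ∉ S →
      ∀ 𝔔 ∈ u.primesAbove, ∀ g ∈ 𝔔.inertia (absoluteGaloisGroup L), κ₁ g = 1)
    (hunr₂ : ∀ u : HeightOneSpectrum (𝓞 L), u.under (𝓞 ℚ) ∉ S →
      ∀ 𝔔 ∈ u.primesAbove, ∀ g ∈ 𝔔.inertia (absoluteGaloisGroup L), κ₂ g = 1)
    (heq₁ : ∀ (γ : absoluteGaloisGroup ℚ) (σ : absoluteGaloisGroup L),
      κ₁ (absGaloisOuterConj ℚ L γ σ) = κ₁ σ ^ ((θ γ : (ZMod p)ˣ) : ZMod p).val)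
    (heq₂ : ∀ (γ : absoluteGaloisGroup ℚ) (σ : absoluteGaloisGroup L),
      κ₂ (absGaloisOuterConj ℚ L γ σ) = κ₂ σ ^ ((θ γ : (ZMod p)ˣ) : ZMod p).val)
    (hind : ∀ a b : ℕ, κ₁ ^ a * κ₂ ^ b = 1 → p ∣ a ∧ p ∣ b) :
    p ^ 2 ≤ Nat.card ↥(h1Unramified A S) := by
  set V := Subgroup.closure ({κ₁, κ₂} : Set (absoluteGaloisGroup L →* Multiplicative (ZMod p))) with hV
  haveI : Finite V := finite_closure_pair κ₁ κ₂
  refine (sq_le_natCard_closure_pair hind).trans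
    (natCard_characters_le_natCard_h1Unramified hcard hcont θ hθ hpL hrL hS V ?_ ?_ ?_)
  · intro κ hκ
    obtain ⟨a, b, -, -, rfl⟩ := exists_eq_pow_mul_pow_of_mem_closure_pair hκ
    exact isOpen_ker_pow_mul_pow hopen₁ hopen₂ a b
  · intro κ hκ u hu 𝔔 h𝔔 g hg
    obtain ⟨a, b, -, -, rfl⟩ := exists_eq_pow_mul_pow_of_mem_closure_pair hκ
    exact pow_mul_pow_apply_eq_one (hunr₁ u hu 𝔔 h𝔔 g hg) (hunr₂ u hu 𝔔 h𝔔 g hg) a b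
  · intro κ hκ γ σ
    obtain ⟨a, b, -, -, rfl⟩ := exists_eq_pow_mul_pow_of_mem_closure_pair hκ
    exact pow_mul_pow_apply_eq_pow (heq₁ γ σ) (heq₂ γ σ) a b

omit hp [IsGalois ℚ L] in
/-- `u ∩ ℚ ∉ S_p` ⟹ `u ∤ p` (the place currency of the bridge vs. the one of `KummerRadical.kummer_character_eq_one_of_mem_inertia`).
[folklore] -/
theorem natCast_not_mem_of_under_not_mem {u : HeightOneSpectrum (𝓞 L)}
    (hu : u.under (𝓞 ℚ) ∉ {v' : HeightOneSpectrum (𝓞 ℚ) | ((p : ℕ) : 𝓞 ℚ) ∈ v'.asIdeal}) :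
    ((p : ℕ) : 𝓞 L) ∉ u.asIdeal := by
  intro h
  apply hu
  rw [Set.mem_setOf_eq, HeightOneSpectrum.under_asIdeal, Ideal.under_def, Ideal.mem_comap, map_natCast]
  exact h

end Supply

/-! ## §4 On the CM-ramified class: (LA) ∧ two admissible independent characters ⟹ `Ш(W/ℚ)[p] ≠ 0` -/

section Class

variable (W : WeierstrassCurve ℚ) [W.IsElliptic] [W.IsGloballyMinimal]
variable {p : ℕ} [hp : Fact p.Prime]

/-- **(LA) ∧ TWO ADMISSIBLE INDEPENDENT `θ`-ISOTYPIC CHARACTERS ⟹ `Ш(W/ℚ)[p] ≠ 0` ON THE CM-RAMIFIED CLASS, granted the local Euler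
characteristic.** `W/ℚ` globally minimal with CM, `p ≥ 5` ramified in the CM field, `rank W(ℚ) = 1`, `v ∋ p`, `Φ ≤ W[p]` a stable line of
order `p` on which `Γ_ℚ` acts through `θ : Γ_ℚ →* 𝔽_pˣ`, such that every rational local point `P ∈ W(ℚ_v)` has a `Φ`-adapted `p`-th root
(w6 g4's (LA), CASE R when `Φ` carries the odd character); `L/ℚ` finite Galois with `p ∤ [L:ℚ]` and `θ(res Γ_L) = 1`; `κ₁, κ₂ : Γ_L →* 𝔽_p`
with open kernels, trivial on the inertia groups above every `u ∤ p`, `θ`-isotypic under the outer action of `Γ_ℚ`, independent; ASSUME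
`localEulerPoincareCharacteristic ℚ_v`. THEN `Ш(W/ℚ)` has a non-zero element killed by `p` — §3 feeds `#R_rel(Φ) ≥ p²` to seat g10's
`exists_sha_ne_zero_of_forall_exists_adaptedRoot_of_sq_le_of_cmRamified`. READING (B1-sha): with `L = K'` the CM field of the odd
character, `κ₁` the Kummer character of Herbrand's even unit and `κ₂` that of an even class radical (`θ_e` irregular), this is
«CASE R ∧ EVEN-IRREGULAR ⟹ `Ш(W_ψ)[p] ≠ 0`». [cite: MilneADT2006, Ch. I §2 Thm. 2.8] [cite: Washington1997, §10.2]
[cite: SilvermanAEC2009, Thm. X.4.2] -/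
theorem exists_sha_ne_zero_of_forall_exists_adaptedRoot_of_two_characters_of_cmRamified
    (hCM : W.HasCM) (hram : CMRamified W p) (h5 : 5 ≤ p) (hrank : W.mordellWeilRank = 1)
    {v : HeightOneSpectrum (𝓞 ℚ)} (hpv : ((p : ℕ) : 𝓞 ℚ) ∈ v.asIdeal)
    (hEP : localEulerPoincareCharacteristic (v.adicCompletion ℚ))
    (Φ : StableSubgroup (absoluteGaloisGroup ℚ) (geomTorsion W (p : ℤ))) (hcard : Nat.card Φ.Sub = p)
    (hLA : ∀ P : (W.baseChange (v.adicCompletion ℚ)).toAffine.Point,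
      ∃ R : localPoints W (v.adicCompletion ℚ),
        (p : ℤ) • R = Affine.Point.map (W' := W)
          (IsScalarTower.toAlgHom ℚ (v.adicCompletion ℚ) (AlgebraicClosure (v.adicCompletion ℚ))) P ∧
        ∀ σ : absoluteGaloisGroup (v.adicCompletion ℚ), ∃ t ∈ Φ.toAddSubgroup,
          σ • R - R = pointsMap W (v.adicCompletion ℚ) (t : geomPoints W))
    (θ : absoluteGaloisGroup ℚ →* (ZMod p)ˣ)
    (hθ : ∀ (g : absoluteGaloisGroup ℚ) (s : Φ.Sub), g • s = (((θ g : ZMod p).val : ℕ) : ℤ) • s)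
    {L : Type} [Field L] [NumberField L] [IsGalois ℚ L] (hpL : ¬ p ∣ Module.finrank ℚ L)
    (hrL : ∀ σ : absoluteGaloisGroup L, θ (absGaloisRestrict ℚ L σ) = 1)
    (κ₁ κ₂ : absoluteGaloisGroup L →* Multiplicative (ZMod p))
    (hopen₁ : IsOpen (κ₁.ker : Set (absoluteGaloisGroup L))) (hopen₂ : IsOpen (κ₂.ker : Set (absoluteGaloisGroup L)))
    (hunr₁ : ∀ u : HeightOneSpectrum (𝓞 L), ((p : ℕ) : 𝓞 L) ∉ u.asIdeal →
      ∀ 𝔔 ∈ u.primesAbove, ∀ g ∈ 𝔔.inertia (absoluteGaloisGroup L), κ₁ g = 1)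
    (hunr₂ : ∀ u : HeightOneSpectrum (𝓞 L), ((p : ℕ) : 𝓞 L) ∉ u.asIdeal →
      ∀ 𝔔 ∈ u.primesAbove, ∀ g ∈ 𝔔.inertia (absoluteGaloisGroup L), κ₂ g = 1)
    (heq₁ : ∀ (γ : absoluteGaloisGroup ℚ) (σ : absoluteGaloisGroup L),
      κ₁ (absGaloisOuterConj ℚ L γ σ) = κ₁ σ ^ ((θ γ : (ZMod p)ˣ) : ZMod p).val)
    (heq₂ : ∀ (γ : absoluteGaloisGroup ℚ) (σ : absoluteGaloisGroup L),
      κ₂ (absGaloisOuterConj ℚ L γ σ) = κ₂ σ ^ ((θ γ : (ZMod p)ˣ) : ZMod p).val)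
    (hind : ∀ a b : ℕ, κ₁ ^ a * κ₂ ^ b = 1 → p ∣ a ∧ p ∣ b) :
    ∃ c ∈ W.sha, c ≠ 0 ∧ p • c = 0 := by
  have hp0 : ((p : ℕ) : ℤ) ≠ 0 := by exact_mod_cast hp.out.ne_zero
  have hSpfin : {v' : HeightOneSpectrum (𝓞 ℚ) | ((p : ℕ) : 𝓞 ℚ) ∈ v'.asIdeal}.Finite := by
    convert finite_setOf_intCast_mem_asIdeal (K := ℚ) hp0 using 1
    ext v'
    simp only [Set.mem_setOf_eq, Int.cast_natCast]
  have hcont : ∀ s : Φ.Sub, Continuous fun g : absoluteGaloisGroup ℚ ↦ g • s :=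
    Φ.continuous_smul_sub (LevelDictionary.continuous_smul_geomTorsion W (p : ℤ))
  exact exists_sha_ne_zero_of_forall_exists_adaptedRoot_of_sq_le_of_cmRamified W hCM hram h5 hrank hpv hEP Φ hcard hLA
    (sq_le_natCard_h1Unramified_of_two_characters hcard hcont θ hθ hpL hrL hSpfin κ₁ κ₂ hopen₁ hopen₂
      (fun u hu => hunr₁ u (natCast_not_mem_of_under_not_mem hu))
      (fun u hu => hunr₂ u (natCast_not_mem_of_under_not_mem hu)) heq₁ heq₂ hind)

end Class

end Summit.BirchSwinnertonDyer.BirchSwinnertonDyer.Theorems.PrintCFram.SelmerCount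

end
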